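import Mathlib
import Summits.Ventures.PercRepro2.TypedUnmarkedCount
import Summits.Ventures.PercRepro2.TypedResidualCoreK5
import Summits.Ventures.PercRepro2.TypedHatsAll
import Summits.Ventures.PercRepro2.K5StarGenMain

/-!
# Row 2′TRI and (HCOV) on every graph with at most six vertices (blind cell PercRepro2, mine-2
g42, 2026-08-29; `proofs/MINE2-SIXV.md` §3, row M2-87)

The composition of the cell's one-star theorems into ONE class theorem.  The reduction calculus
never creates an unmarked typed vertex (`unmarkedTyped`, TypedUnmarkedCount.lean: the ends of
typed edges outside the five marks) — the number of unmarked typed vertices is a **hereditary**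
quantity (`hereditary_unmarked_le`), so the spine relative to the class «at most one unmarked typed
vertex» (`typedCount_nonneg_of_residual_hered`) needs row 2′TRI only on the residual instances
of that class, and there everything is a theorem of the tree: the all-marked instances are
typer-1's `K₅` base (`allMarkedTRI_all`), the others carry exactly one unmarked typed vertex `u`
of typed degree `≥ 3` whose typed edges all go to marks — a hat (degree `3` with both roots,
`typedCount_nonneg_of_hats`), a one-star of degree `3` (p2's `typedCount_nonneg_of_oneStar` on
`K5.starCerts_holds`) or a one-star of degree `≥ 4` (`typedCount_nonneg_of_oneStarGen` on
`K5.starCertsGen_holds`, mine-2 g41); a mark coincidence outside `MarksDistinct` kills the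
count.

* **`typedCount_nonneg_of_residual_unmarked_le_one`** — row 2′TRI on the residual instances with
  at most one unmarked typed vertex;
* **`typedCount_nonneg_of_unmarked_le_one`** — row 2′TRI on EVERY instance with at most one
  unmarked typed vertex (every pinning, every type map);
* **`TypedBases_of_card_le`**, **`TypedBases_of_card_le_six`** — the typed bases on every vertex
  type with at most one vertex outside the marks, in particular on at most six vertices with the
  five marks distinct;
* **`HCov_of_card_le_six`**, **`HCov_all_card_le_six`** — (HCOV) on every graph with at most six
  vertices, for every admissible weight vector: `HCov_all` restricted to `|V| ≤ 6` is a theorem.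

Own code; standard axioms; no `native_decide`.
-/

namespace Summit.Ventures.PercRepro2

open UnionCluster

namespace CovForm

namespace TypedRed

open Contract

/-! ## The residual instances with at most one unmarked typed vertex -/

section Residual

variable {V : Type*} {E : Type*} [Fintype V] [DecidableEq V] [Fintype E] [DecidableEq E]
variable {R : Type*} [Field R] [LinearOrder R] [IsStrictOrderedRing R]

omit [Fintype V] [DecidableEq V] [Fintype E] [DecidableEq E] in
/-- A vertex `u` with exactly three typed edges `e₁, e₂, e₃` to `v₁, v₂, v₃`, two of which are the
roots, is a hat (the typed graph loop-free and parallel-free). -/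
lemma isHat_of_three {ends : E → Sym2 V} {o a₁ a₂ a₃ b u v₁ v₂ v₃ : V} {F : Finset E}
    {e₁ e₂ e₃ : E} (h12 : a₁ ≠ a₂) (hpar : ∀ e ∈ F, ∀ f ∈ F, e ≠ f → ends e ≠ ends f)
    (he₁ : e₁ ∈ F) (he₂ : e₂ ∈ F) (he₃ : e₃ ∈ F) (h₁₂ : e₁ ≠ e₂) (h₁₃ : e₁ ≠ e₃) (h₂₃ : e₂ ≠ e₃)
    (hE₁ : ends e₁ = s(u, v₁)) (hE₂ : ends e₂ = s(u, v₂)) (hE₃ : ends e₃ = s(u, v₃))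
    (hv₁ : v₁ ≠ u) (hv₂ : v₂ ≠ u) (hv₃ : v₃ ≠ u)
    (hcl : ∀ e ∈ F, u ∈ ends e → e = e₁ ∨ e = e₂ ∨ e = e₃)
    (hroots : (v₁ = a₁ ∨ v₂ = a₁ ∨ v₃ = a₁) ∧ (v₁ = a₂ ∨ v₂ = a₂ ∨ v₃ = a₂)) :
    IsHat ends o a₁ a₂ a₃ b F u := by
  -- the other ends are pairwise distinct (no parallel typed pair)
  have hne : ∀ {e f : E} {v w : V}, e ∈ F → f ∈ F → e ≠ f → ends e = s(u, v) → ends f = s(u, w) →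
      v ≠ w := by
    intro e f v w he hf hef hE hF hvw
    exact hpar e he f hf hef (by rw [hE, hF, hvw])
  have h12' := hne he₁ he₂ h₁₂ hE₁ hE₂
  have h13' := hne he₁ he₃ h₁₃ hE₁ hE₃
  have h23' := hne he₂ he₃ h₂₃ hE₂ hE₃
  rcases hroots with ⟨h1 | h1 | h1, h2 | h2 | h2⟩
  · exact absurd (h1.symm.trans h2) h12
  · -- `e₁ → a₁`, `e₂ → a₂`, the hat edge `e₃`
    refine ⟨v₃, e₃, e₁, e₂, hv₃, ?_, ?_, he₃, he₁, he₂, h₁₃.symm, h₂₃.symm, h₁₂, hE₃,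
      by rw [hE₁, h1], by rw [hE₂, h2], fun e he hu => ?_⟩
    · rw [← h1]; exact h13'.symm
    · rw [← h2]; exact h23'.symm
    · rcases hcl e he hu with rfl | rfl | rfl
      · exact Or.inr (Or.inl rfl)
      · exact Or.inr (Or.inr rfl)
      · exact Or.inl rfl
  · -- `e₁ → a₁`, `e₃ → a₂`, the hat edge `e₂`
    refine ⟨v₂, e₂, e₁, e₃, hv₂, ?_, ?_, he₂, he₁, he₃, h₁₂.symm, h₂₃, h₁₃, hE₂,
      by rw [hE₁, h1], by rw [hE₃, h2], fun e he hu => ?_⟩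
    · rw [← h1]; exact h12'.symm
    · rw [← h2]; exact h23'
    · rcases hcl e he hu with rfl | rfl | rfl
      · exact Or.inr (Or.inl rfl)
      · exact Or.inl rfl
      · exact Or.inr (Or.inr rfl)
  · -- `e₂ → a₁`, `e₁ → a₂`, the hat edge `e₃`
    refine ⟨v₃, e₃, e₂, e₁, hv₃, ?_, ?_, he₃, he₂, he₁, h₂₃.symm, h₁₃.symm, h₁₂.symm, hE₃,
      by rw [hE₂, h1], by rw [hE₁, h2], fun e he hu => ?_⟩
    · rw [← h1]; exact h23'.symm
    · rw [← h2]; exact h13'.symm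
    · rcases hcl e he hu with rfl | rfl | rfl
      · exact Or.inr (Or.inr rfl)
      · exact Or.inr (Or.inl rfl)
      · exact Or.inl rfl
  · exact absurd (h1.symm.trans h2) h12
  · -- `e₂ → a₁`, `e₃ → a₂`, the hat edge `e₁`
    refine ⟨v₁, e₁, e₂, e₃, hv₁, ?_, ?_, he₁, he₂, he₃, h₁₂, h₁₃, h₂₃, hE₁,
      by rw [hE₂, h1], by rw [hE₃, h2], fun e he hu => ?_⟩
    · rw [← h1]; exact h12'
    · rw [← h2]; exact h13'
    · rcases hcl e he hu with rfl | rfl | rfl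
      · exact Or.inl rfl
      · exact Or.inr (Or.inl rfl)
      · exact Or.inr (Or.inr rfl)
  · -- `e₃ → a₁`, `e₁ → a₂`, the hat edge `e₂`
    refine ⟨v₂, e₂, e₃, e₁, hv₂, ?_, ?_, he₂, he₃, he₁, h₂₃, h₁₂.symm, h₁₃.symm, hE₂,
      by rw [hE₃, h1], by rw [hE₁, h2], fun e he hu => ?_⟩
    · rw [← h1]; exact h23'
    · rw [← h2]; exact h12'.symm
    · rcases hcl e he hu with rfl | rfl | rfl
      · exact Or.inr (Or.inr rfl)
      · exact Or.inl rfl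
      · exact Or.inr (Or.inl rfl)
  · -- `e₃ → a₁`, `e₂ → a₂`, the hat edge `e₁`
    refine ⟨v₁, e₁, e₃, e₂, hv₁, ?_, ?_, he₁, he₃, he₂, h₁₃, h₁₂, h₂₃.symm, hE₁,
      by rw [hE₃, h1], by rw [hE₂, h2], fun e he hu => ?_⟩
    · rw [← h1]; exact h13'
    · rw [← h2]; exact h12'
    · rcases hcl e he hu with rfl | rfl | rfl
      · exact Or.inl rfl
      · exact Or.inr (Or.inr rfl)
      · exact Or.inr (Or.inl rfl)
  · exact absurd (h1.symm.trans h2) h12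

/-- **Row 2′TRI on the residual instances with at most one unmarked typed vertex** — unconditional:
the all-marked ones are the `K₅` base, the others carry one unmarked typed vertex of degree `≥ 3`
whose typed edges go to marks — a hat, a one-star of degree `3`, or a one-star of degree `≥ 4`. -/
theorem typedCount_nonneg_of_residual_unmarked_le_one (ends : E → Sym2 V) (o a₁ a₂ a₃ b : V)
    (F : Finset E) (τ : E → ℕ) (hτ : ∀ e ∈ F, τ e = 1 ∨ τ e = 2)
    (hres : Residual ends o a₁ a₂ a₃ b F) (h1 : (unmarkedTyped ends o a₁ a₂ a₃ b F).card ≤ 1) :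
    0 ≤ typedCount F (fun _ => false) τ
      (K3 ends o a₁ a₂ a₃ b : Config E → Config E → Config E → R) := by
  have hred := hres.reduced
  by_cases hm : MarksDistinct o a₁ a₂ a₃ b
  swap
  · rw [typedCount_eq_zero_of_not_marksDistinct ends hm]
  by_cases hall : AllMarked ends o a₁ a₂ a₃ b F
  · exact K5.typedCount_K3_nonneg_allMarked ends hm.1.1 hm.1.2.1 hm.1.2.2.1 hm.1.2.2.2.1
      hm.1.2.2.2.2.1 hm.1.2.2.2.2.2.1 hm.1.2.2.2.2.2.2 hm.2 F τ hred.no_loop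
      (fun e he e' he' h => by_contra fun hne => hred.no_parallel e he e' he' hne h) hall
  -- the unmarked typed vertex `u`
  obtain ⟨e₀, he₀, u, hue₀, huo, hu1, hu2, hu3, hub⟩ := exists_unmarked_of_not_allMarked hall
  have huU : u ∈ unmarkedTyped ends o a₁ a₂ a₃ b F :=
    mem_unmarkedTyped.2 ⟨⟨e₀, he₀, hue₀⟩, huo, hu1, hu2, hu3, hub⟩
  -- every unmarked typed vertex is `u`
  have huniq : ∀ v, (∃ e ∈ F, v ∈ ends e) → v ≠ o → v ≠ a₁ → v ≠ a₂ → v ≠ a₃ → v ≠ b → v = u := by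
    intro v hv hvo hv1 hv2 hv3 hvb
    have hvU : v ∈ unmarkedTyped ends o a₁ a₂ a₃ b F :=
      mem_unmarkedTyped.2 ⟨hv, hvo, hv1, hv2, hv3, hvb⟩
    by_contra hne
    have h2 : 2 ≤ (unmarkedTyped ends o a₁ a₂ a₃ b F).card := by
      have hsub : ({v, u} : Finset V) ⊆ unmarkedTyped ends o a₁ a₂ a₃ b F := by
        intro x hx
        rcases Finset.mem_insert.1 hx with rfl | hx
        · exact hvU
        · rw [Finset.mem_singleton.1 hx]; exact huU
      rw [← Finset.card_pair hne]
      exact Finset.card_le_card hsub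
    omega
  -- every end of a typed edge is `u` or a mark
  have hends : ∀ e ∈ F, ∀ v ∈ ends e, v = u ∨ (v = o ∨ v = a₁ ∨ v = a₂ ∨ v = a₃ ∨ v = b) := by
    intro e he v hv
    by_cases hmk : v = o ∨ v = a₁ ∨ v = a₂ ∨ v = a₃ ∨ v = b
    · exact Or.inr hmk
    · exact Or.inl (huniq v ⟨e, he, hv⟩ (fun h => hmk (Or.inl h)) (fun h => hmk (Or.inr (Or.inl h)))
        (fun h => hmk (Or.inr (Or.inr (Or.inl h))))
        (fun h => hmk (Or.inr (Or.inr (Or.inr (Or.inl h)))))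
        (fun h => hmk (Or.inr (Or.inr (Or.inr (Or.inr h))))))
  -- the star at `u`
  set L := F.filter (fun e => u ∈ ends e) with hL
  have hmemL : ∀ e, e ∈ L ↔ e ∈ F ∧ u ∈ ends e := fun e => Finset.mem_filter
  have hother : ∀ e ∈ L, ∃ v, ends e = s(u, v) ∧ v ≠ u ∧
      (v = o ∨ v = a₁ ∨ v = a₂ ∨ v = a₃ ∨ v = b) := by
    intro e he
    obtain ⟨heF, hue⟩ := (hmemL e).1 he
    obtain ⟨v, hv, huv⟩ := exists_other_end hred.no_loop heF hue
    refine ⟨v, hv, huv.symm, ?_⟩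
    rcases hends e heF v (by rw [hv]; exact Sym2.mem_mk_right _ _) with h | h
    · exact absurd h huv.symm
    · exact h
  haveI : Nonempty V := ⟨u⟩
  choose! nbr hnbr using hother
  -- the typed edges off the star join marks
  have hoff : ∀ e ∈ F, e ∉ L → ∀ v ∈ ends e, v = o ∨ v = a₁ ∨ v = a₂ ∨ v = a₃ ∨ v = b := by
    intro e he heL v hv
    rcases hends e he v hv with h | h
    · rw [h] at hv
      exact absurd ((hmemL e).2 ⟨he, hv⟩) heL
    · exact h
  -- the typed degree of `u` is at least three
  have hdeg : 3 ≤ L.card := hred.typedDeg_unmarked huo hu1 hu2 hu3 hub he₀ hue₀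
  rcases Nat.lt_or_ge L.card 4 with hlt | hge
  · -- degree three: a hat or a one-star
    obtain ⟨e₁, e₂, e₃, h₁₂, h₁₃, h₂₃, hL3⟩ := Finset.card_eq_three.1 (by omega : L.card = 3)
    have he₁L : e₁ ∈ L := by rw [hL3]; simp
    have he₂L : e₂ ∈ L := by rw [hL3]; simp
    have he₃L : e₃ ∈ L := by rw [hL3]; simp
    obtain ⟨hE₁, hv₁u, hv₁m⟩ := hnbr e₁ he₁L
    obtain ⟨hE₂, hv₂u, hv₂m⟩ := hnbr e₂ he₂L
    obtain ⟨hE₃, hv₃u, hv₃m⟩ := hnbr e₃ he₃L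
    have hcl : ∀ e ∈ F, u ∈ ends e → e = e₁ ∨ e = e₂ ∨ e = e₃ := by
      intro e he hu
      have : e ∈ L := (hmemL e).2 ⟨he, hu⟩
      rw [hL3] at this
      simpa using this
    have hnotL : ∀ e ∈ F, e ≠ e₁ → e ≠ e₂ → e ≠ e₃ → e ∉ L := by
      intro e _ hn1 hn2 hn3 heL
      rw [hL3] at heL
      simp only [Finset.mem_insert, Finset.mem_singleton] at heL
      rcases heL with h | h | h
      · exact hn1 h
      · exact hn2 h
      · exact hn3 h
    by_cases hroots : (nbr e₁ = a₁ ∨ nbr e₂ = a₁ ∨ nbr e₃ = a₁) ∧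
        (nbr e₁ = a₂ ∨ nbr e₂ = a₂ ∨ nbr e₃ = a₂)
    · -- both roots: `u` is a hat, and every unmarked typed vertex is `u`
      have hhat : IsHat ends o a₁ a₂ a₃ b F u :=
        isHat_of_three hm.1.1 hred.no_parallel ((hmemL e₁).1 he₁L).1 ((hmemL e₂).1 he₂L).1
          ((hmemL e₃).1 he₃L).1 h₁₂ h₁₃ h₂₃ hE₁ hE₂ hE₃ hv₁u hv₂u hv₃u hcl hroots
      have hhats : Hats ends o a₁ a₂ a₃ b F := by
        intro w hwo hw1 hw2 hw3 hwb hw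
        rw [huniq w hw hwo hw1 hw2 hw3 hwb]
        exact hhat
      exact typedCount_nonneg_of_hats F ends o a₁ a₂ a₃ b τ hm hred.no_loop
        (fun e he _ => hτ e he) hhats
    · -- at most one root: a one-star of degree three
      have hstar : OneStar ends o a₁ a₂ a₃ b F :=
        ⟨u, nbr e₁, nbr e₂, nbr e₃, e₁, e₂, e₃, ⟨huo, hu1, hu2, hu3, hub⟩, hv₁m, hv₂m, hv₃m,
          ((hmemL e₁).1 he₁L).1, ((hmemL e₂).1 he₂L).1, ((hmemL e₃).1 he₃L).1, h₁₂, h₁₃, h₂₃,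
          hE₁, hE₂, hE₃, hroots, fun e he hn1 hn2 hn3 v hv => hoff e he (hnotL e he hn1 hn2 hn3) v hv⟩
      exact typedCount_nonneg_of_oneStar (K5.starCerts_holds R) ends o a₁ a₂ a₃ b F τ hτ hm
        hred.no_loop hred.no_parallel hstar
  · -- degree at least four: a one-star of degree `≥ 4`
    have hstar : OneStarGen ends o a₁ a₂ a₃ b F := by
      refine ⟨u, nbr, L.toList, ⟨huo, hu1, hu2, hu3, hub⟩, Finset.nodup_toList L, ?_, ?_, ?_⟩
      · rw [Finset.length_toList]; exact hge
      · intro e he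
        rw [Finset.mem_toList] at he
        exact ⟨((hmemL e).1 he).1, (hnbr e he).1, (hnbr e he).2.2⟩
      · intro e he heL
        rw [Finset.mem_toList] at heL
        exact hoff e he heL
    exact typedCount_nonneg_of_oneStarGen K5.starCertsGen_holds ends o a₁ a₂ a₃ b F τ hτ hm
      hred.no_loop hred.no_parallel hstar

end Residual

/-! ## The class theorems -/

section Class

variable {V : Type*} {E : Type*} [Fintype V] [DecidableEq V] [Fintype E] [DecidableEq E]
variable {R : Type*} [Field R] [LinearOrder R] [IsStrictOrderedRing R]

/-- **Row 2′TRI on every instance with at most one unmarked typed vertex** — every pinning, every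
type map (the hereditary spine with the residual case above). -/
theorem typedCount_nonneg_of_unmarked_le_one (ends : E → Sym2 V) (o a₁ a₂ a₃ b : V) (F : Finset E)
    (z : Config E) (τ : E → ℕ) (hτ : ∀ e ∈ F, τ e = 1 ∨ τ e = 2)
    (h1 : (unmarkedTyped ends o a₁ a₂ a₃ b F).card ≤ 1) :
    0 ≤ typedCount F z τ (K3 ends o a₁ a₂ a₃ b : Config E → Config E → Config E → R) :=
  typedCount_nonneg_of_residual_hered (hereditary_unmarked_le 1)
    (fun ends o a₁ a₂ a₃ b F τ hτ hres h1 =>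
      typedCount_nonneg_of_residual_unmarked_le_one ends o a₁ a₂ a₃ b F τ hτ hres h1)
    ends o a₁ a₂ a₃ b F z τ hτ h1

/-- **The typed bases on every vertex type with at most one vertex outside the marks.** -/
theorem TypedBases_of_card_le (ends : E → Sym2 V) (o a₁ a₂ a₃ b : V)
    (hV : Fintype.card V ≤ (markSet o a₁ a₂ a₃ b).card + 1) :
    TypedBases (R := R) ends o a₁ a₂ a₃ b :=
  fun F z τ hτ => typedCount_nonneg_of_unmarked_le_one ends o a₁ a₂ a₃ b F z τ hτ
    (by have := card_unmarkedTyped_le ends o a₁ a₂ a₃ b F; omega)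

/-- **The typed bases on at most six vertices with the five marks distinct** (row 2′TRI as a class
theorem on `|V| ≤ 6`). -/
theorem TypedBases_of_card_le_six (ends : E → Sym2 V) (o a₁ a₂ a₃ b : V) (hV : Fintype.card V ≤ 6)
    (h12 : a₁ ≠ a₂) (h13 : a₁ ≠ a₃) (h23 : a₂ ≠ a₃) (ho1 : o ≠ a₁) (ho2 : o ≠ a₂) (ho3 : o ≠ a₃)
    (hob : o ≠ b) (hb1 : b ≠ a₁) (hb2 : b ≠ a₂) (hb3 : b ≠ a₃) :
    TypedBases (R := R) ends o a₁ a₂ a₃ b :=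
  TypedBases_of_card_le ends o a₁ a₂ a₃ b
    (by rw [card_markSet_of_distinct h12 h13 h23 ho1 ho2 ho3 hob hb1 hb2 hb3]; omega)

/-- **(HCOV) on every graph with at most six vertices**, for every admissible weight vector and
every choice of five distinct marks. -/
theorem HCov_of_card_le_six (ends : E → Sym2 V) (p : E → R) (hp : IsProbVec p) (o a₁ a₂ a₃ b : V)
    (hV : Fintype.card V ≤ 6) (h12 : a₁ ≠ a₂) (h13 : a₁ ≠ a₃) (h23 : a₂ ≠ a₃) (ho1 : o ≠ a₁)
    (ho2 : o ≠ a₂) (ho3 : o ≠ a₃) (hob : o ≠ b) (hb1 : b ≠ a₁) (hb2 : b ≠ a₂) (hb3 : b ≠ a₃) :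
    HCov p ends o a₁ a₂ a₃ b :=
  HCov_of_typedBases ends o a₁ a₂ a₃ b
    (TypedBases_of_card_le_six ends o a₁ a₂ a₃ b hV h12 h13 h23 ho1 ho2 ho3 hob hb1 hb2 hb3) p hp

end Class

section Closure

variable (R : Type*) [Field R] [LinearOrder R] [IsStrictOrderedRing R]

/-- **`HCov_all` restricted to the graphs on at most six vertices is a theorem**: the crux of record
(DEMO-PACKET §(c)) holds on every finite graph with at most six vertices, for every admissible
weight vector and every choice of five distinct marks. -/
theorem HCov_all_card_le_six :
    ∀ (V E : Type) [Fintype V] [DecidableEq V] [Fintype E] [DecidableEq E], Fintype.card V ≤ 6 →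
      ∀ (ends : E → Sym2 V) (p : E → R), IsProbVec p →
        ∀ o a₁ a₂ a₃ b : V, a₁ ≠ a₂ → a₁ ≠ a₃ → a₂ ≠ a₃ → o ≠ a₁ → o ≠ a₂ → o ≠ a₃ → o ≠ b →
          b ≠ a₁ → b ≠ a₂ → b ≠ a₃ → HCov p ends o a₁ a₂ a₃ b :=
  fun _ _ _ _ _ _ hV ends p hp o a₁ a₂ a₃ b h12 h13 h23 ho1 ho2 ho3 hob hb1 hb2 hb3 =>
    HCov_of_card_le_six ends p hp o a₁ a₂ a₃ b hV h12 h13 h23 ho1 ho2 ho3 hob hb1 hb2 hb3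

end Closure

end TypedRed

end CovForm

end Summit.Ventures.PercRepro2
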